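import Mathlib
import Literature.AlgebraicGeometry.Resolution.ResolutionOfSingularities
import Literature.AlgebraicGeometry.Resolution.ResolutionGlue
import Summits.ResolutionOfSingularities.ResolutionOfSingularities.Theorems.FrobeniusLadderFRationalResolutionResolutionOpenGlue
import Summits.ResolutionOfSingularities.ResolutionOfSingularities.Theorems.FrobeniusLadderFRationalResolutionResolutionOpenGlue2
import HarnessLib

/-!
# Symmetric open gluing of two proper models with a Zariski-local property
(crux `FrobeniusLadder.FRationalResolution`, line `Sketch`)

Stub `stub_model_glue2` of the skeleton `Sketch` for crux stmt-ResolutionOfSingularities-15317: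
the two-piece gluing step of "proper models with property `P` exist Zariski-locally ⇒ globally",
for an arbitrary property `P` of schemes which glues along two-piece open covers (`hPglue`). This
generalises `stub_hasResolution_glue2` (`…ResolutionOpenGlue2.lean`, the case `P = Scheme.IsRegular`),
whose push-out lemmas are reused verbatim.

A scheme `X` is covered by the ranges of two open immersions `iA : A → X`, `iB : B → X`; `W ⊆ X` is
an open containing `iA(A) ∩ iB(B)`; `α : A' → A` and `β : B' → B` are proper morphisms from schemes
satisfying `P` which are isomorphisms over `iA⁻¹ W`, `iB⁻¹ W`, with dense preimages of these opens.
Then `X` receives a proper morphism `π : X' → X` from a scheme satisfying `P` which is an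
isomorphism over `W`, with dense preimage of `W`.

Construction: `O := iA(A) ∩ iB(B)` (an open subscheme of `X`, `O ⊆ W`). Since `α` is an
isomorphism over `iA⁻¹ W ⊇ iA⁻¹ O`, the inclusion `O ⊆ X` lifts uniquely to an open immersion
`b : O → A'` with `b ≫ α ≫ iA = O.ι` (`exists_openGlue_leg`), and symmetrically `a : O → B'`.
`X' := A' ⨿_O B'` is the push-out of the open immersions `b`, `a` (Mathlib: colimit of a locally
directed diagram of open immersions; the legs are open immersions and jointly surjective, so
`P X'` follows from `hPglue`), and `π := pushout.desc (α ≫ iA) (β ≫ iB)`. Pointwise bookkeeping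
gives `π⁻¹(iA(A)) = inl(A')` and `π⁻¹(iB(B)) = inr(B')`, whence the cartesian squares
`IsPullback α inl iA π`, `IsPullback β inr iB π` (`IsOpenImmersion.isPullback`). So `π` is `α` over
`iA(A)` and `β` over `iB(B)`: proper (properness is Zariski-local on the target); pasting with the
restriction squares, `π` is `α ∣_ iA⁻¹W` over `iA(A) ∩ W` and `β ∣_ iB⁻¹W` over `iB(B) ∩ W`, hence
an isomorphism over their union `W` (`isIso_morphismRestrict_sup`); and `π⁻¹ W` is dense since its
traces on the open pieces `inl(A') ≅ A'`, `inr(B') ≅ B'` are the dense opens `α⁻¹ iA⁻¹ W`,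
`β⁻¹ iB⁻¹ W`.
-/

set_option linter.dupNamespace false

noncomputable section

open CategoryTheory CategoryTheory.Limits AlgebraicGeometry TopologicalSpace
  Literature.AlgebraicGeometry.Resolution

universe u

namespace Summit.ResolutionOfSingularities.ResolutionOfSingularities.Theorems.FRationalResolution

section Pushout

variable {Wt U Y : Scheme.{u}} (b : Wt ⟶ U) (a : Wt ⟶ Y) [IsOpenImmersion b] [IsOpenImmersion a]

/-- The two legs of the push-out `U ⨿_W Y` of two open immersions cover it: the union of their
(open) ranges is everything (the legs are jointly surjective, `openGlue_point_cases`). -/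
theorem openGlue_opensRange_sup_eq_top [IsOpenImmersion (pushout.inl b a)]
    [IsOpenImmersion (pushout.inr b a)] :
    (pushout.inl b a).opensRange ⊔ (pushout.inr b a).opensRange = ⊤ := by
  refine Opens.ext ?_
  rw [Opens.coe_sup, Opens.coe_top, Scheme.Hom.coe_opensRange, Scheme.Hom.coe_opensRange]
  refine Set.eq_univ_of_forall fun z => ?_
  rcases openGlue_point_cases b a z with ⟨u, rfl⟩ | ⟨y, rfl⟩
  · exact Or.inl ⟨u, rfl⟩
  · exact Or.inr ⟨y, rfl⟩

end Pushout

/-- SYMMETRIC OPEN GLUING OF TWO PROPER MODELS WITH A ZARISKI-LOCAL PROPERTY `P`. `X` covered by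
the ranges of two open immersions `iA : A → X`, `iB : B → X`; `W ⊆ X` an open containing `A ∩ B`;
`α : A' → A` and `β : B' → B` proper morphisms from schemes satisfying `P` which are isomorphisms
over `iA⁻¹ W` resp. `iB⁻¹ W` with dense preimages of these; `P` glues along two-piece open covers.
Then `X` receives a proper `π : X' → X` from a scheme satisfying `P`, an isomorphism over `W` with
dense preimage of `W`: `X' = A' ⨿_{A ∩ B} B'`, glued along `α⁻¹(A ∩ B) ≅ A ∩ B ≅ β⁻¹(A ∩ B)`,
`π = pushout.desc (α ≫ iA) (β ≫ iB)`; `π⁻¹(iA A) = inl A'` and `π⁻¹(iB B) = inr B'` give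
`IsPullback α inl iA π`, `IsPullback β inr iB π`, so `π` is proper (Zariski-local on the target)
and an isomorphism over `W ∩ A` and `W ∩ B`, hence over `W`; `P X'` from `hPglue` applied to the
open cover `X' = inl A' ∪ inr B'`; density from the two dense pieces.
[Stacks 01JA (gluing schemes); folklore] -/
theorem stub_model_glue2 (P : Scheme.{0} → Prop)
    (hPglue : ∀ (Z U Y : Scheme.{0}) (i : U ⟶ Z) (j : Y ⟶ Z) [IsOpenImmersion i]
      [IsOpenImmersion j], i.opensRange ⊔ j.opensRange = ⊤ → P U → P Y → P Z)
    (X A B A' B' : Scheme.{0}) (iA : A ⟶ X) [IsOpenImmersion iA]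
    (iB : B ⟶ X) [IsOpenImmersion iB] (hcover : iA.opensRange ⊔ iB.opensRange = ⊤)
    (W : X.Opens) (hW : iA.opensRange ⊓ iB.opensRange ≤ W)
    (α : A' ⟶ A) [IsProper α] (hA' : P A') (hα : IsIso (α ∣_ (iA ⁻¹ᵁ W)))
    (hαd : Dense ((α ⁻¹ᵁ (iA ⁻¹ᵁ W) : A'.Opens) : Set A'))
    (β : B' ⟶ B) [IsProper β] (hB' : P B') (hβ : IsIso (β ∣_ (iB ⁻¹ᵁ W)))
    (hβd : Dense ((β ⁻¹ᵁ (iB ⁻¹ᵁ W) : B'.Opens) : Set B')) :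
    ∃ (X' : Scheme.{0}) (π : X' ⟶ X), IsProper π ∧ P X' ∧ IsIso (π ∣_ W) ∧
      Dense ((π ⁻¹ᵁ W : X'.Opens) : Set X') := by
  -- the overlap `O = iA(A) ∩ iB(B) ⊆ W`, an open subscheme of `X`
  set O : X.Opens := iA.opensRange ⊓ iB.opensRange with hO_def
  have hOr : O.ι.opensRange = O := Scheme.Opens.opensRange_ι O
  -- the two legs `b : O → A'`, `a : O → B'`
  obtain ⟨b, hbo, hb, hbr⟩ := exists_openGlue_leg α iA W hα O.ι
    (by rw [hOr]; exact inf_le_left) (by rw [hOr]; exact hW)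
  obtain ⟨a, hao, ha, har⟩ := exists_openGlue_leg β iB W hβ O.ι
    (by rw [hOr]; exact inf_le_right) (by rw [hOr]; exact hW)
  haveI := hbo
  haveI := hao
  have hcomm : b ≫ α ≫ iA = a ≫ β ≫ iB := hb.trans ha.symm
  set π : pushout b a ⟶ X := pushout.desc (α ≫ iA) (β ≫ iB) hcomm
  have hπl : pushout.inl b a ≫ π = α ≫ iA := pushout.inl_desc _ _ _
  have hπr : pushout.inr b a ≫ π = β ≫ iB := pushout.inr_desc _ _ _
  haveI := openGlue_isOpenImmersion_inl b a
  haveI := openGlue_isOpenImmersion_inr b a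
  have hπl' : ∀ u : A', π (pushout.inl b a u) = iA (α u) := fun u => by
    rw [← Scheme.Hom.comp_apply, hπl, Scheme.Hom.comp_apply]
  have hπr' : ∀ y : B', π (pushout.inr b a y) = iB (β y) := fun y => by
    rw [← Scheme.Hom.comp_apply, hπr, Scheme.Hom.comp_apply]
  -- `π⁻¹(iA(A)) = inl(A')`
  have hA : π ⁻¹ᵁ iA.opensRange = (pushout.inl b a).opensRange := by
    refine Opens.ext ?_
    rw [Scheme.Hom.coe_opensRange]
    refine openGlue_preimage_eq_range_inl b a π _ (fun u => ?_) (fun y hy => ?_)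
    · rw [hπl']
      exact ⟨α u, rfl⟩
    · rw [hπr'] at hy
      exact har y (by rw [hOr]; exact Opens.mem_inf.mpr ⟨hy, ⟨β y, rfl⟩⟩)
  -- `π⁻¹(iB(B)) = inr(B')`
  have hB : π ⁻¹ᵁ iB.opensRange = (pushout.inr b a).opensRange := by
    refine Opens.ext ?_
    rw [Scheme.Hom.coe_opensRange]
    refine openGlue_preimage_eq_range_inr b a π _ (fun y => ?_) (fun u hu => ?_)
    · rw [hπr']
      exact ⟨β y, rfl⟩
    · rw [hπl'] at hu
      exact hbr u (by rw [hOr]; exact Opens.mem_inf.mpr ⟨⟨α u, rfl⟩, hu⟩)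
  -- the two cartesian squares
  have sqA : IsPullback α (pushout.inl b a) iA π := IsOpenImmersion.isPullback _ _ _ _ hπl hA
  have sqB : IsPullback β (pushout.inr b a) iB π := IsOpenImmersion.isPullback _ _ _ _ hπr hB
  -- `P` holds on the push-out: it glues along the open cover `inl(A') ∪ inr(B')`
  have hP : P (pushout b a) :=
    hPglue (pushout b a) A' B' (pushout.inl b a) (pushout.inr b a)
      (openGlue_opensRange_sup_eq_top b a) hA' hB'
  refine ⟨pushout b a, π, ?_, hP, ?_, ?_⟩
  · -- properness is Zariski-local on the target
    have hpA : IsProper (π ∣_ iA.opensRange) :=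
      morphismRestrict_opensRange_of_isPullback π _ α iA sqA @IsProper inferInstance
    have hpB : IsProper (π ∣_ iB.opensRange) :=
      morphismRestrict_opensRange_of_isPullback π _ β iB sqB @IsProper inferInstance
    refine IsZariskiLocalAtTarget.of_iSup_eq_top (P := @IsProper)
      (fun c : Bool => cond c iA.opensRange iB.opensRange)
      ((sup_eq_iSup _ _).symm.trans hcover) ?_
    rintro (_ | _)
    · exact hpB
    · exact hpA
  · -- `π` is an isomorphism over `W = (iA(A) ∩ W) ∪ (iB(B) ∩ W)`
    have h := isIso_morphismRestrict_sup π
      (isIso_morphismRestrict_inf_of_isPullback α _ iA π sqA W hα)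
      (isIso_morphismRestrict_inf_of_isPullback β _ iB π sqB W hβ)
    have e : iA.opensRange ⊓ W ⊔ iB.opensRange ⊓ W = W := by
      rw [← inf_sup_right, hcover, top_inf_eq]
    rw [e] at h
    exact h
  · -- density of `π⁻¹ W`: its traces on `A'` and `B'` are `α⁻¹ iA⁻¹ W` and `β⁻¹ iB⁻¹ W`
    refine openGlue_dense b a _ ?_ ?_
    · have e : (pushout.inl b a) ⁻¹' ((π ⁻¹ᵁ W : (pushout b a).Opens) : Set ↥(pushout b a)) =
          ((α ⁻¹ᵁ (iA ⁻¹ᵁ W) : A'.Opens) : Set A') := by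
        ext u
        show π (pushout.inl b a u) ∈ W ↔ iA (α u) ∈ W
        rw [hπl']
      rw [e]
      exact hαd
    · have e : (pushout.inr b a) ⁻¹' ((π ⁻¹ᵁ W : (pushout b a).Opens) : Set ↥(pushout b a)) =
          ((β ⁻¹ᵁ (iB ⁻¹ᵁ W) : B'.Opens) : Set B') := by
        ext y
        show π (pushout.inr b a y) ∈ W ↔ iB (β y) ∈ W
        rw [hπr']
      rw [e]
      exact hβd

end Summit.ResolutionOfSingularities.ResolutionOfSingularities.Theorems.FRationalResolution

end
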